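import Literature.Analysis.FluidPDE.LerayHopfRestartTorus
import HarnessLib

/-!
# Bounded ancient Leray–Hopf trajectories and the weak global attractor on the flat torus

Analysis/FluidPDE definitions file (all proved; no named facts). For the forced incompressible
Navier–Stokes equations on `T^d` at a FIXED viscosity `ν`, Foias–Temam (1985/1987) and
Foias–Manley–Rosa–Temam 2001, Ch. III §3, (3.46) define the **weak global attractor**

  `𝒜_w = {u₀ ∈ H ; there exists a weak solution u = u(t), defined on ℝ and uniformly bounded`
  `        in H, such that u(0) = u₀}`                                        (FMRT (3.46))

and record its invariance «at any other time `t ∈ ℝ` the velocity field `u(t)` also belongs to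
`𝒜_w`» (FMRT (3.48)), the bound `𝒜_w ⊆ {|u| ≤ |f|/(ν λ₁)}` (3.47), weak attraction (3.49) and
weak compactness (3.50) (proofs in App. III.A.5).

In the tree's vocabulary a "weak solution defined on ℝ" is phrased with the accepted
`Torus.IsGlobalLerayHopf ν f u₀ u` (Leray–Hopf on every `[0, T)`): a trajectory
`w : ℝ → T^d → ℝ^d` is a **bounded ancient Leray–Hopf trajectory** (`IsBoundedAncientLerayHopf`)
when it restarts as a global Leray–Hopf solution from arbitrarily early times `s → -∞` and from
time `0`, and `sup_t ∫ ‖w t‖² < ∞`; the **weak global attractor** `weakGlobalAttractor ν f` is the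
set of time-`0` slices of such trajectories.  For a time-dependent force the restarted trajectory
`t ↦ w (t + s)` is driven by the restarted force `t ↦ f (t + s)`; for a steady force
`f = fun _ => g` this is `fun _ => g` again (definitionally), which is the setting of FMRT Ch. III
and of the consumer (route AttractorShadow, item `LoudSlimAttractorPoints`, whose inlined clause is
`isBoundedAncientLerayHopf_iff` verbatim).

Faithfulness note. FMRT's weak solutions on `ℝ` satisfy the energy inequality from almost every
initial time (Ch. II (7.20)); the Leray–Hopf clauses used here ask it from the restart times `s`
and from `0` themselves (plus strong right-continuity in `L²` there).  Every bounded weak solution on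
`ℝ` in FMRT's sense restarts in this way from a.e. time (`IsGlobalLerayHopf.ae_isGlobalLerayHopf_translate`,
Robinson–Rodrigo–Sadowski 2016, Def. 4.9 and p. 131), so the two notions have the same trajectories
read at restart-good times; the invariance (3.48) accordingly holds here in the conditional form
`IsBoundedAncientLerayHopf.shift` (shift to any restart-good time) and, for a steady smooth force
and `ν ≥ 0`, at almost every time (`IsBoundedAncientLerayHopf.ae_shift`,
`IsBoundedAncientLerayHopf.ae_mem_weakGlobalAttractor`).

Provided API (all proved): unfolding lemmas, the projections, `memLp` of every slice
(`𝒜_w ⊆ H`), membership of the time-`0` slice and of early restart slices in `𝒜_w`, the shift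
lemmas above, and `of_steady` / `mem_weakGlobalAttractor_of_steady` (a steady Leray–Hopf state is a
bounded ancient trajectory, so stationary solutions lie on `𝒜_w`; FMRT Ch. III (3.35)).
NOT formalized here: the bound (3.47), weak attraction (3.49) / App. A.5 (shift-compactness) and
weak compactness (3.50).

## References

* C. Foias, O. Manley, R. Rosa, R. Temam, *Navier–Stokes Equations and Turbulence*, Encyclopedia
  Math. Appl. 83, CUP 2001, Ch. III §3 (3.46)–(3.50), App. III.A.5; Ch. IV (4.3)–(4.6).
  [FoiasManleyRosaTemam2001]
* C. Foias, R. Temam, The connection between the Navier–Stokes equations, dynamical systems, and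
  turbulence theory, in *Directions in Partial Differential Equations* (1987), 55–73 (origin of
  `𝒜_w`, as cited by FMRT p. 165).
* J. C. Robinson, J. L. Rodrigo, W. Sadowski, *The three-dimensional Navier–Stokes equations*,
  CUP 2016, Def. 4.9, p. 131 (restarting at a.e. time). [RobinsonRodrigoSadowski2016]
-/

noncomputable section

open MeasureTheory Set Filter

namespace Literature.Analysis.FluidPDE.Torus

variable {d : Type*} [Fintype d] [DecidableEq d]

/-- **Bounded ancient Leray–Hopf trajectory** of the forced Navier–Stokes equations on `T^d`
with viscosity `ν` and force `f` — a point-carrying trajectory of the weak global attractor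
(Foias–Manley–Rosa–Temam 2001, Ch. III (3.46): «a weak solution `u = u(t)`, defined on `ℝ` and
uniformly bounded in `H`»), in the tree's Leray–Hopf vocabulary: `w` restarts as a global
Leray–Hopf solution (accepted `Torus.IsGlobalLerayHopf`, with the restarted force) from
arbitrarily early times `s ≤ -T` and from time `0`, and `t ↦ ∫ ‖w t‖²` is bounded on `ℝ`.
[cite: FoiasManleyRosaTemam2001, Ch. III (3.46)] -/
def IsBoundedAncientLerayHopf (ν : ℝ) (f : ℝ → UnitAddTorus d → EuclideanSpace ℝ d)
    (w : ℝ → UnitAddTorus d → EuclideanSpace ℝ d) : Prop :=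
  (∀ T : ℝ, ∃ s : ℝ, s ≤ -T ∧
      IsGlobalLerayHopf ν (fun t => f (t + s)) (w s) (fun t => w (t + s))) ∧
    IsGlobalLerayHopf ν f (w 0) w ∧ ∃ M : ℝ, ∀ t : ℝ, (∫ x, ‖w t x‖ ^ 2) ≤ M

/-- **The weak global attractor** `𝒜_w(ν, f)` of the forced Navier–Stokes equations on `T^d`
(Foias–Temam; Foias–Manley–Rosa–Temam 2001, Ch. III (3.46), Ch. IV (4.3)): the time-`0` slices
of the bounded ancient Leray–Hopf trajectories (`IsBoundedAncientLerayHopf`).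
[cite: FoiasManleyRosaTemam2001, Ch. III (3.46)] -/
def weakGlobalAttractor (ν : ℝ) (f : ℝ → UnitAddTorus d → EuclideanSpace ℝ d) :
    Set (UnitAddTorus d → EuclideanSpace ℝ d) :=
  {v | ∃ w : ℝ → UnitAddTorus d → EuclideanSpace ℝ d, IsBoundedAncientLerayHopf ν f w ∧ w 0 = v}

variable {ν : ℝ} {f : ℝ → UnitAddTorus d → EuclideanSpace ℝ d}
  {g : UnitAddTorus d → EuclideanSpace ℝ d} {w : ℝ → UnitAddTorus d → EuclideanSpace ℝ d}
  {v U : UnitAddTorus d → EuclideanSpace ℝ d}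

/-- Unfolding of `IsBoundedAncientLerayHopf` (definitional). [cite: FoiasManleyRosaTemam2001, Ch. III (3.46)] -/
theorem isBoundedAncientLerayHopf_iff :
    IsBoundedAncientLerayHopf ν f w ↔
      (∀ T : ℝ, ∃ s : ℝ, s ≤ -T ∧
          IsGlobalLerayHopf ν (fun t => f (t + s)) (w s) (fun t => w (t + s))) ∧
        IsGlobalLerayHopf ν f (w 0) w ∧ ∃ M : ℝ, ∀ t : ℝ, (∫ x, ‖w t x‖ ^ 2) ≤ M :=
  Iff.rfl

/-- Unfolding of `IsBoundedAncientLerayHopf` for a STEADY force `fun _ => g` — the restarted force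
is `fun _ => g` again; this is the clause inlined verbatim in item `LoudSlimAttractorPoints` of route
AttractorShadow (definitional). [cite: FoiasManleyRosaTemam2001, Ch. III (3.46)] -/
theorem isBoundedAncientLerayHopf_const_iff :
    IsBoundedAncientLerayHopf ν (fun _ => g) w ↔
      (∀ T : ℝ, ∃ s : ℝ, s ≤ -T ∧
          IsGlobalLerayHopf ν (fun _ => g) (w s) (fun t => w (t + s))) ∧
        IsGlobalLerayHopf ν (fun _ => g) (w 0) w ∧ ∃ M : ℝ, ∀ t : ℝ, (∫ x, ‖w t x‖ ^ 2) ≤ M :=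
  Iff.rfl

/-- Unfolding of membership in the weak global attractor (definitional; FMRT (3.46)). [cite: FoiasManleyRosaTemam2001, Ch. III (3.46)] -/
theorem mem_weakGlobalAttractor_iff :
    v ∈ weakGlobalAttractor ν f ↔
      ∃ w : ℝ → UnitAddTorus d → EuclideanSpace ℝ d, IsBoundedAncientLerayHopf ν f w ∧ w 0 = v :=
  Iff.rfl

namespace IsBoundedAncientLerayHopf

/-- A bounded ancient Leray–Hopf trajectory restarts as a global Leray–Hopf solution from
arbitrarily early times (projection). [cite: FoiasManleyRosaTemam2001, Ch. III (3.46)] -/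
theorem exists_restart_le (h : IsBoundedAncientLerayHopf ν f w) (T : ℝ) :
    ∃ s : ℝ, s ≤ -T ∧ IsGlobalLerayHopf ν (fun t => f (t + s)) (w s) (fun t => w (t + s)) :=
  h.1 T

/-- A bounded ancient Leray–Hopf trajectory is a global Leray–Hopf solution from its time-`0`
slice (projection). [cite: FoiasManleyRosaTemam2001, Ch. III (3.46)] -/
theorem isGlobalLerayHopf (h : IsBoundedAncientLerayHopf ν f w) : IsGlobalLerayHopf ν f (w 0) w :=
  h.2.1

/-- The kinetic energy of a bounded ancient Leray–Hopf trajectory is bounded on `ℝ`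
(projection; «uniformly bounded in `H`», FMRT (3.46)). [cite: FoiasManleyRosaTemam2001, Ch. III (3.46)] -/
theorem exists_forall_integral_norm_sq_le (h : IsBoundedAncientLerayHopf ν f w) :
    ∃ M : ℝ, ∀ t : ℝ, (∫ x, ‖w t x‖ ^ 2) ≤ M :=
  h.2.2

/-- The time-`0` slice of a bounded ancient Leray–Hopf trajectory lies on the weak global
attractor (definitional; FMRT (3.46)). [cite: FoiasManleyRosaTemam2001, Ch. III (3.46)] -/
theorem mem_weakGlobalAttractor (h : IsBoundedAncientLerayHopf ν f w) :
    w 0 ∈ weakGlobalAttractor ν f :=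
  ⟨w, h, rfl⟩

/-- **Every slice of a bounded ancient Leray–Hopf trajectory is in `L²`** (`u(t) ∈ H` for all
`t ∈ ℝ`, FMRT (3.46)/(3.48)): for `t ≥ 0` from the solution restarted at `0`, for `t < 0` from a
restart at some `s ≤ t` (field `memLp` of `Torus.IsLerayHopfOn`). [cite: FoiasManleyRosaTemam2001, Ch. III (3.46)] -/
theorem memLp (h : IsBoundedAncientLerayHopf ν f w) (t : ℝ) : MemLp (w t) 2 volume := by
  rcases le_or_gt 0 t with ht | ht
  · exact (h.2.1 (t + 1) (by linarith)).memLp t ⟨ht, by linarith⟩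
  · obtain ⟨s, hs, hS⟩ := h.1 (-t)
    have hst : s ≤ t := by linarith
    have hm := (hS (t - s + 1) (by linarith)).memLp (t - s) ⟨by linarith, by linarith⟩
    simpa only [sub_add_cancel] using hm

/-- **Invariance under time shifts, conditional form** (FMRT (3.48) «at any other time `t ∈ ℝ`
the velocity field `u(t)` also belongs to `𝒜_w`», read at a restart-good time): if the bounded
ancient trajectory `w` restarts as a global Leray–Hopf solution from time `τ`, then the shifted
trajectory `t ↦ w (t + τ)` (force `t ↦ f (t + τ)`) is again bounded ancient Leray–Hopf.
[cite: FoiasManleyRosaTemam2001, Ch. III (3.48)] -/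
theorem shift (h : IsBoundedAncientLerayHopf ν f w) (τ : ℝ)
    (hτ : IsGlobalLerayHopf ν (fun t => f (t + τ)) (w τ) (fun t => w (t + τ))) :
    IsBoundedAncientLerayHopf ν (fun t => f (t + τ)) (fun t => w (t + τ)) := by
  refine ⟨fun T => ?_, by simpa only [zero_add] using hτ, ?_⟩
  · obtain ⟨s₀, hs₀, hS⟩ := h.1 (T - τ)
    refine ⟨s₀ - τ, by linarith, ?_⟩
    have e : ∀ t : ℝ, t + (s₀ - τ) + τ = t + s₀ := fun t => by ring
    simpa only [e, sub_add_cancel] using hS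
  · obtain ⟨M, hM⟩ := h.2.2
    exact ⟨M, fun t => hM (t + τ)⟩

/-- A restart-good slice `w τ` of a bounded ancient Leray–Hopf trajectory lies on the weak global
attractor of the restarted force (FMRT (3.48), conditional form).
[cite: FoiasManleyRosaTemam2001, Ch. III (3.48)] -/
theorem mem_weakGlobalAttractor_of_restart (h : IsBoundedAncientLerayHopf ν f w) (τ : ℝ)
    (hτ : IsGlobalLerayHopf ν (fun t => f (t + τ)) (w τ) (fun t => w (t + τ))) :
    w τ ∈ weakGlobalAttractor ν (fun t => f (t + τ)) :=
  ⟨fun t => w (t + τ), h.shift τ hτ, by simp only [zero_add]⟩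

/-- Arbitrarily early slices of a bounded ancient Leray–Hopf trajectory lie on the weak global
attractor (of the restarted force): the early restart times of the definition are restart-good.
[cite: FoiasManleyRosaTemam2001, Ch. III (3.48)] -/
theorem exists_le_mem_weakGlobalAttractor (h : IsBoundedAncientLerayHopf ν f w) (T : ℝ) :
    ∃ s : ℝ, s ≤ -T ∧ w s ∈ weakGlobalAttractor ν (fun t => f (t + s)) := by
  obtain ⟨s, hs, hS⟩ := h.1 T
  exact ⟨s, hs, h.mem_weakGlobalAttractor_of_restart s hS⟩

/-- **Restarting at almost every time** (steady smooth force `g`, `ν ≥ 0`): a bounded ancient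
Leray–Hopf trajectory restarts as a global Leray–Hopf solution from almost every time `τ ∈ ℝ`
(Robinson–Rodrigo–Sadowski 2016, Def. 4.9 / p. 131, via the tree's
`IsGlobalLerayHopf.ae_isGlobalLerayHopf_translate`, applied from a sequence of restart times
`s_n ≤ -n`). [cite: RobinsonRodrigoSadowski2016, Def. 4.9 and p. 131] -/
theorem ae_restart (hg : FunctionSpaces.Torus.IsSmooth g) (hν : 0 ≤ ν)
    (h : IsBoundedAncientLerayHopf ν (fun _ => g) w) :
    ∀ᵐ τ ∂volume, IsGlobalLerayHopf ν (fun _ => g) (w τ) (fun t => w (t + τ)) := by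
  -- restart times `s n ≤ -n`
  choose s hs hS using fun n : ℕ => h.1 (n : ℝ)
  -- from each `s n`, the translate restarts at a.e. later time
  have hn : ∀ n : ℕ, ∀ᵐ τ ∂volume, s n < τ →
      IsGlobalLerayHopf ν (fun _ => g) (w τ) (fun t => w (t + τ)) := by
    intro n
    have h1 : ∀ᵐ σ ∂volume, 0 < σ →
        IsGlobalLerayHopf ν (fun _ => g) (w (σ + s n)) (fun t => w (t + σ + s n)) :=
      (hS n).ae_isGlobalLerayHopf_translate hg hν
    have hmp : MeasurePreserving (fun τ : ℝ => τ - s n) volume volume :=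
      measurePreserving_sub_right volume (s n)
    have h2 : ∀ᵐ σ ∂(volume.map fun τ : ℝ => τ - s n), 0 < σ →
        IsGlobalLerayHopf ν (fun _ => g) (w (σ + s n)) (fun t => w (t + σ + s n)) := by
      rw [hmp.map_eq]
      exact h1
    filter_upwards [ae_of_ae_map hmp.aemeasurable h2] with τ hτ hlt
    have e : ∀ t : ℝ, t + (τ - s n) + s n = t + τ := fun t => by ring
    simpa only [e, sub_add_cancel, sub_pos] using hτ (sub_pos.2 hlt)
  rw [← ae_all_iff] at hn
  filter_upwards [hn] with τ hτ
  obtain ⟨n, hn'⟩ := exists_nat_gt (-τ)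
  exact hτ n (by linarith [hs n])

/-- **Invariance under time shifts at almost every time** (FMRT (3.48), steady smooth force,
`ν ≥ 0`): for a.e. `τ ∈ ℝ` the shifted trajectory `t ↦ w (t + τ)` is again a bounded ancient
Leray–Hopf trajectory. [cite: FoiasManleyRosaTemam2001, Ch. III (3.48)] -/
theorem ae_shift (hg : FunctionSpaces.Torus.IsSmooth g) (hν : 0 ≤ ν)
    (h : IsBoundedAncientLerayHopf ν (fun _ => g) w) :
    ∀ᵐ τ ∂volume, IsBoundedAncientLerayHopf ν (fun _ => g) (fun t => w (t + τ)) := by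
  filter_upwards [h.ae_restart hg hν] with τ hτ
  exact h.shift τ hτ

/-- **Almost every slice lies on the weak global attractor** (FMRT (3.48) «`u(t)` also belongs to
`𝒜_w`», steady smooth force, `ν ≥ 0`, at the restart-good times).
[cite: FoiasManleyRosaTemam2001, Ch. III (3.48)] -/
theorem ae_mem_weakGlobalAttractor (hg : FunctionSpaces.Torus.IsSmooth g) (hν : 0 ≤ ν)
    (h : IsBoundedAncientLerayHopf ν (fun _ => g) w) :
    ∀ᵐ τ ∂volume, w τ ∈ weakGlobalAttractor ν (fun _ => g) := by
  filter_upwards [h.ae_restart hg hν] with τ hτ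
  exact h.mem_weakGlobalAttractor_of_restart τ hτ

/-- **Steady Leray–Hopf states are bounded ancient trajectories**: if the constant trajectory
`t ↦ U` is a global Leray–Hopf solution with the steady force `g` from the datum `U`, then it is
bounded ancient Leray–Hopf (restart from any `s`: the same solution; bound `∫ ‖U‖²`).
(Stationary solutions lie on the attractor; FMRT Ch. III (3.35)/(3.46).) [cite: FoiasManleyRosaTemam2001, Ch. III (3.46)] -/
theorem of_steady (hU : IsGlobalLerayHopf ν (fun _ => g) U (fun _ => U)) :
    IsBoundedAncientLerayHopf ν (fun _ => g) (fun _ => U) :=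
  ⟨fun T => ⟨-T, le_rfl, hU⟩, hU, ⟨∫ x, ‖U x‖ ^ 2, fun _ => le_rfl⟩⟩

end IsBoundedAncientLerayHopf

/-- Points of the weak global attractor are square-integrable (`𝒜_w ⊆ H`, FMRT (3.46)). [cite: FoiasManleyRosaTemam2001, Ch. III (3.46)] -/
theorem memLp_of_mem_weakGlobalAttractor (hv : v ∈ weakGlobalAttractor ν f) : MemLp v 2 volume := by
  obtain ⟨w, hw, rfl⟩ := hv
  exact hw.memLp 0

/-- **Stationary Leray–Hopf solutions lie on the weak global attractor** (FMRT Ch. III (3.35),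
(3.46)). [cite: FoiasManleyRosaTemam2001, Ch. III (3.46)] -/
theorem mem_weakGlobalAttractor_of_steady (hU : IsGlobalLerayHopf ν (fun _ => g) U (fun _ => U)) :
    U ∈ weakGlobalAttractor ν (fun _ => g) :=
  (IsBoundedAncientLerayHopf.of_steady hU).mem_weakGlobalAttractor

end Literature.Analysis.FluidPDE.Torus

end
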